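import Summits.QuantumFields.BalabanUV.Beta.GAN24.PerfectStepFibre

/-!
# `BalabanUV.Beta.GAN24.PerfectStepBloch` — binder row G-an2-4 ∕ (CONV-C), lineage gan24-p3 (part P3, Woodbury ∕ fibre layer):
# **THE PERFECT ONE-STEP RESOLVENT IS A BLOCH KERNEL** — its entry `((x′,a),(y′,b))` is `[LegOn] · Re (2π)^{−(d+1)} ∫_{[-π,π]^{d+1}} e^{ip·(X′−Y′)} kΔ_∞^{ab}(ξ′,η′; p) dp`
# with `X′ = quo Lc x′` the BLOCK LABEL, `ξ′ = repZ (proj Lc x′)` the INTRA-BLOCK RESIDUE, and ONE bounded multiplier `kFibΔLim` per residue pair and leg pair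
# (finitely many), CONTINUOUS on the real zone — the `j → ∞` limit of road P1's re-based fibre functions `CombesThomasFibreStep.kFibΔ … j`

NOT IN PRINT; OUR PROOF (bookkeeping over tree theorems BY NAME).  HONEST FRAMING (cell contract, verbatim): «discharging `BetaPertH` makes Bałaban's UV
stability UNCONDITIONAL — a real constructive-QFT result; it is NOT the continuum limit and NOT the Clay problem.»  HONEST DEPENDENCY (verbatim): «continuum
YM on T⁴ ⇐ BetaPertH ∧ nine spine estimates (0/9 proved); BetaPertH ⇐ (D1) ∧ (D4) ∧ CAP+tail; G-an2-4 gates asym, D1 and NE2/3/4.»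

WHAT.  `GAN24.PerfectStepFibre` (this lineage) named the real-zone limit `kFibLim` of road P1's `kFib … j a x′ b y′` and proved `KPerf … 1 x′ y′ a b =
[LegOn] · Re latticeKernel (kFibLim … a x′ b y′) 0` — one multiplier per pair of block OFFSETS `(x′, y′)`, the offsets riding in the phases.  leaf-01's
`GAN24.FibreStepResidues` proved, at every finite `j`, that the RE-BASED fibre function `kFibΔ_j = cphase (quo y′ − quo x′) · kFib_j` is EXACTLY invariant under
block translations of either base point and depends on `(x′, y′)` only through the residues (`kFibΔ_eq_repZ`), while `kFib_j` carries the global phase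
`cphase (quo x′ − quo y′)` (`kFib_eq_repZ`).  This file passes those identities to the limit and rewrites the perfect resolvent in BLOCH FORM.
* §1 `kFibΔLim Lc a x′ b y′ := cphase (quo Lc y′ − quo Lc x′) · kFibLim Lc a x′ b y′`; `tendsto_kFibΔ_kFibΔLim` (real zone, under (I2′)); `norm_kFibΔLim_le` (≤ Cst under
  (I3′)); `norm_kFibΔ_sub_kFibΔLim_le` (the same uniform tail `c·θ^j/(1−θ)`); EXACT BLOCK-TRANSLATION INVARIANCE `kFibΔLim_add_zsmul_left/right` and the RESIDUE
  REDUCTION `kFibΔLim_eq_repZ` ON THE REAL ZONE (limits of leaf-01's finite-`j` identities); the phase law `kFibLim_eq_cphase_mul_repZ`: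
  `kFibLim … x′ … y′ (p) = cphase (quo x′ − quo y′)(p) · kFibΔLim … (repZ (proj x′)) … (repZ (proj y′)) (p)`.
* §2 CONTINUITY: `continuousOn_kFibΔ` (each `kFibΔ_j ∘ ofRealVec` is continuous on the zone — (I3′) strip regularity), `tendstoUniformlyOn_kFibΔ` (the convergence is UNIFORM
  on the zone — the tail of §1 is `p`-free), **`continuousOn_kFibΔLim`** (uniform limits of continuous functions).
* §3 **`KPerf_one_eq_bloch_of_shapes`** (general `d`, under (I2′) ∧ (I3′)) and **`KPerf_one_eq_bloch`** (`d = 3`, every `Lc ≥ 2`, UNCONDITIONAL):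
  `KPerf Lc (sfStep Lc) (smStep d Lc) 1 x′ y′ a b = [LegOn Lc a x′ ∧ LegOn Lc b y′] · Re latticeKernel (kFibΔLim Lc a (repZ (proj Lc x′)) b (repZ (proj Lc y′))) (quo Lc x′ − quo Lc y′)`
  (`B4Green244.latticeKernel_congr` on the real-zone phase law + `CombesThomasFibreStep.latticeKernel_cphase_mul_zero`); + the `d = 3` instances
  `continuousOn_kFibΔLim_holds`, `exists_norm_kFibΔLim_le`, `kFibΔLim_eq_repZ_holds`.
HONEST: structure of a NAMED limit; no closed (alias-sum) form, no `m ≥ 2`, no decay rate beyond what `FP.SymmetryKHolds.decays_KPerf_one_holds` already gives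
(strip HOLOMORPHY of `kFibΔLim` would need convergence OFF the real zone, which (I2′) does not assert — NOT claimed); 0 wall binders instantiated; NOT «N0b-K closed»,
NEVER «G-an2-4 closed», NOT BetaPertH, NOT continuum, NOT Clay.

ABSOLUTE RULE (cell, verbatim): «No internally-minted statement may enter as a cited fact. Every hypothesis is either kernel-proved in this package or a
verbatim quotation of a PUBLISHED theorem with page reference.»  Nothing is cited; no `def … : Prop`; one data `def` (`kFibΔLim`); every input is a tree
theorem imported BY NAME.
-/

namespace Summit.QuantumFields.BalabanUV.Beta.GAN24.PerfectStepBloch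

open Filter Topology MeasureTheory Complex
open Literature.Probability.LatticeModels (Torus.proj)
open Literature.MathematicalPhysics.QuantumFieldTheory
open Literature.MathematicalPhysics.QuantumFieldTheory.Balaban1983to89
open Literature.MathematicalPhysics.QuantumFieldTheory.Balaban1983to89.Beta
open B4Strip (ofRealVec Strip)
open B4ContourShift (BZ integrand latticeKernel StripRegular ofRealVec_mem_Strip continuous_ofRealVec)
open B4Green244 (latticeKernel_congr)
open FibreInverseDecay (cphase)
open LatticeForm (quo repZ)
open BlochFibreUniqueness (quo_repZ)
open OneStepResolventKernel (Fib)
open Summit.QuantumFields.BalabanUV.Beta.GAN24.CombesThomas (sfStep smStep)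
open Summit.QuantumFields.BalabanUV.Beta.GAN24.CombesThomasFibre (LegOn)
open Summit.QuantumFields.BalabanUV.Beta.GAN24.CombesThomasFibreStep (kFib kFibΔ cphase_add_eq_mul cphase_zero_left latticeKernel_cphase_mul_zero)
open Summit.QuantumFields.BalabanUV.Beta.GAN24.ConvCKOfShapes (RealRateK StripRegularK)
open Summit.QuantumFields.BalabanUV.Beta.GAN24.FibreRate (cFF cMF realRateK)
open Summit.QuantumFields.BalabanUV.Beta.GAN24.FibreRateOfLegs (cmm)
open Summit.QuantumFields.BalabanUV.Beta.GAN24.FibreStrip (fibreStrip)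
open Summit.QuantumFields.BalabanUV.Beta.GAN24.FibreStepResidues (norm_cphase_ofRealVec kFib_eq_repZ kFibΔ_add_zsmul_left kFibΔ_add_zsmul_right)
open Summit.QuantumFields.BalabanUV.Beta.FP.PerfectObjectsT (KPerf)
open Summit.QuantumFields.BalabanUV.Beta.GAN24.PerfectStepFibre (kFibLim tendsto_kFib_kFibLim norm_kFib_sub_kFibLim_le norm_kFibLim_le Cst_nonneg
  norm_kFibΔ_ofRealVec norm_kFib_ofRealVec_le KPerf_one_eq_fibre_of_shapes theta_nonneg_lt_one)

noncomputable section

/-! ## §1 The re-based limit fibre function: block-translation invariance and residue reduction -/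

section Generic

variable {d : ℕ} {Lc : ℕ} [NeZero Lc]

/-- [our object] **THE RE-BASED LIMIT FIBRE FUNCTION** `kFibΔLim Lc a x′ b y′ := cphase (quo Lc y′ − quo Lc x′) · kFibLim Lc a x′ b y′` — the limit twin of road P1's
`kFibΔ … j = cphase (quo Lc y′ − quo Lc x′) · kFib … j` (`CombesThomasFibreStep.kFibΔ`). -/
def kFibΔLim (Lc : ℕ) [NeZero Lc] (a : Fib d) (x' : Fin (d + 1) → ℤ) (b : Fib d) (y' : Fin (d + 1) → ℤ) :
    (Fin (d + 1) → ℂ) → ℂ :=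
  fun P => cphase (quo Lc y' - quo Lc x') P * kFibLim Lc a x' b y' P

/-- [folklore] Unfolding at a point. -/
theorem kFibΔLim_apply (a : Fib d) (x' : Fin (d + 1) → ℤ) (b : Fib d) (y' : Fin (d + 1) → ℤ) (P : Fin (d + 1) → ℂ) :
    kFibΔLim Lc a x' b y' P = cphase (quo Lc y' - quo Lc x') P * kFibLim Lc a x' b y' P := rfl

/-- [folklore] Unfolding road P1's `kFibΔ` at a point. -/
theorem kFibΔ_apply (sf sm : ℕ → ℝ) (j : ℕ) (a : Fib d) (x' : Fin (d + 1) → ℤ) (b : Fib d) (y' : Fin (d + 1) → ℤ)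
    (P : Fin (d + 1) → ℂ) : kFibΔ Lc sf sm j a x' b y' P = cphase (quo Lc y' - quo Lc x') P * kFib Lc sf sm j a x' b y' P := rfl

/-- [our object] **CONVERGENCE OF THE RE-BASED FIBRE FUNCTIONS ON THE REAL ZONE** (under (I2′), `θ < 1`): `kFibΔ … j a x′ b y′ (p) → kFibΔLim … a x′ b y′ (p)`. -/
theorem tendsto_kFibΔ_kFibΔLim {c θ : ℝ} (hθ1 : θ < 1) (hB : RealRateK d Lc c θ) (a : Fib d) (x' : Fin (d + 1) → ℤ) (b : Fib d)
    (y' : Fin (d + 1) → ℤ) {p : Fin (d + 1) → ℝ} (hp : p ∈ BZ (d + 1)) :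
    Tendsto (fun j => kFibΔ Lc (sfStep Lc) (smStep d Lc) j a x' b y' (ofRealVec p)) atTop (𝓝 (kFibΔLim Lc a x' b y' (ofRealVec p))) :=
  (tendsto_kFib_kFibLim hθ1 hB a x' b y' hp).const_mul _

/-- [our object] The re-based tail is the same: `‖kFibΔ_j(p) − kFibΔLim(p)‖ ≤ c·θ^j/(1 − θ)` on the real zone (the phase is unimodular there). -/
theorem norm_kFibΔ_sub_kFibΔLim_le {c θ : ℝ} (hθ1 : θ < 1) (hB : RealRateK d Lc c θ) (a : Fib d) (x' : Fin (d + 1) → ℤ) (b : Fib d)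
    (y' : Fin (d + 1) → ℤ) {p : Fin (d + 1) → ℝ} (hp : p ∈ BZ (d + 1)) (j : ℕ) :
    ‖kFibΔ Lc (sfStep Lc) (smStep d Lc) j a x' b y' (ofRealVec p) - kFibΔLim Lc a x' b y' (ofRealVec p)‖ ≤ c * θ ^ j / (1 - θ) := by
  rw [kFibΔ_apply, kFibΔLim_apply, ← mul_sub, norm_mul, norm_cphase_ofRealVec, one_mul]
  exact norm_kFib_sub_kFibLim_le hθ1 hB a x' b y' hp j

/-- [our object] `‖kFibΔLim … (p)‖ ≤ Cst` on the real zone (under (I2′) ∧ (I3′)). -/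
theorem norm_kFibΔLim_le {c θ κ Cst : ℝ} (hθ1 : θ < 1) (hB : RealRateK d Lc c θ) (hκ : 0 ≤ κ) (hA : StripRegularK d Lc κ Cst)
    (a : Fib d) (x' : Fin (d + 1) → ℤ) (b : Fib d) (y' : Fin (d + 1) → ℤ) {p : Fin (d + 1) → ℝ} (hp : p ∈ BZ (d + 1)) :
    ‖kFibΔLim Lc a x' b y' (ofRealVec p)‖ ≤ Cst := by
  rw [kFibΔLim_apply, norm_mul, norm_cphase_ofRealVec, one_mul]
  exact norm_kFibLim_le hθ1 hB hκ hA a x' b y' hp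

/-- [our object] **EXACT BLOCK-TRANSLATION INVARIANCE IN THE FIRST BASE POINT** (real zone, under (I2′)): `kFibΔLim … a (x′ + Lc•v) b y′ (p) = kFibΔLim … a x′ b y′ (p)`
— leaf-01's `FibreStepResidues.kFibΔ_add_zsmul_left` at every `j`, passed to the limit. -/
theorem kFibΔLim_add_zsmul_left {c θ : ℝ} (hθ1 : θ < 1) (hB : RealRateK d Lc c θ) (a b : Fib d) (x' y' v : Fin (d + 1) → ℤ)
    {p : Fin (d + 1) → ℝ} (hp : p ∈ BZ (d + 1)) :
    kFibΔLim Lc a (x' + (Lc : ℤ) • v) b y' (ofRealVec p) = kFibΔLim Lc a x' b y' (ofRealVec p) := by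
  refine tendsto_nhds_unique (tendsto_kFibΔ_kFibΔLim hθ1 hB a _ b y' hp) ?_
  have h : (fun j => kFibΔ Lc (sfStep Lc) (smStep d Lc) j a (x' + (Lc : ℤ) • v) b y' (ofRealVec p)) =
      fun j => kFibΔ Lc (sfStep Lc) (smStep d Lc) j a x' b y' (ofRealVec p) := by
    funext j; rw [kFibΔ_add_zsmul_left]
  rw [h]
  exact tendsto_kFibΔ_kFibΔLim hθ1 hB a x' b y' hp

/-- [our object] **EXACT BLOCK-TRANSLATION INVARIANCE IN THE SECOND BASE POINT** (real zone, under (I2′)). -/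
theorem kFibΔLim_add_zsmul_right {c θ : ℝ} (hθ1 : θ < 1) (hB : RealRateK d Lc c θ) (a b : Fib d) (x' y' v : Fin (d + 1) → ℤ)
    {p : Fin (d + 1) → ℝ} (hp : p ∈ BZ (d + 1)) :
    kFibΔLim Lc a x' b (y' + (Lc : ℤ) • v) (ofRealVec p) = kFibΔLim Lc a x' b y' (ofRealVec p) := by
  refine tendsto_nhds_unique (tendsto_kFibΔ_kFibΔLim hθ1 hB a x' b _ hp) ?_
  have h : (fun j => kFibΔ Lc (sfStep Lc) (smStep d Lc) j a x' b (y' + (Lc : ℤ) • v) (ofRealVec p)) =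
      fun j => kFibΔ Lc (sfStep Lc) (smStep d Lc) j a x' b y' (ofRealVec p) := by
    funext j; rw [kFibΔ_add_zsmul_right]
  rw [h]
  exact tendsto_kFibΔ_kFibΔLim hθ1 hB a x' b y' hp

/-- [our object] **THE PHASE LAW OF THE LIMIT FIBRE FUNCTION** (real zone, under (I2′)):
`kFibLim … x′ … y′ (p) = cphase (quo Lc x′ − quo Lc y′)(p) · kFibΔLim … (repZ (proj Lc x′)) … (repZ (proj Lc y′)) (p)` — leaf-01's `kFib_eq_repZ` at every `j`, passed
to the limit (the representatives have block label `0`, so their re-basing phase is trivial). -/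
theorem kFibLim_eq_cphase_mul_repZ {c θ : ℝ} (hθ1 : θ < 1) (hB : RealRateK d Lc c θ) (a b : Fib d) (x' y' : Fin (d + 1) → ℤ)
    {p : Fin (d + 1) → ℝ} (hp : p ∈ BZ (d + 1)) :
    kFibLim Lc a x' b y' (ofRealVec p) = cphase (quo Lc x' - quo Lc y') (ofRealVec p) *
      kFibΔLim Lc a (repZ (Torus.proj Lc x')) b (repZ (Torus.proj Lc y')) (ofRealVec p) := by
  have hΔ : kFibΔLim Lc a (repZ (Torus.proj Lc x')) b (repZ (Torus.proj Lc y')) (ofRealVec p) =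
      kFibLim Lc a (repZ (Torus.proj Lc x')) b (repZ (Torus.proj Lc y')) (ofRealVec p) := by
    rw [kFibΔLim_apply, quo_repZ, quo_repZ, sub_zero, cphase_zero_left, one_mul]
  rw [hΔ]
  refine tendsto_nhds_unique (tendsto_kFib_kFibLim hθ1 hB a x' b y' hp) ?_
  have h : (fun j => kFib Lc (sfStep Lc) (smStep d Lc) j a x' b y' (ofRealVec p)) = fun j =>
      cphase (quo Lc x' - quo Lc y') (ofRealVec p) *
        kFib Lc (sfStep Lc) (smStep d Lc) j a (repZ (Torus.proj Lc x')) b (repZ (Torus.proj Lc y')) (ofRealVec p) := by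
    funext j; exact kFib_eq_repZ (sfStep Lc) (smStep d Lc) j a b x' y' _
  rw [h]
  exact (tendsto_kFib_kFibLim hθ1 hB a _ b _ hp).const_mul _

/-- [our object] **RESIDUE REDUCTION** (real zone, under (I2′)): the re-based limit fibre function depends on the base points only through their residues,
`kFibΔLim … a x′ b y′ (p) = kFibΔLim … a (repZ (proj Lc x′)) b (repZ (proj Lc y′)) (p)` — ONE multiplier per residue pair and leg pair. -/
theorem kFibΔLim_eq_repZ {c θ : ℝ} (hθ1 : θ < 1) (hB : RealRateK d Lc c θ) (a b : Fib d) (x' y' : Fin (d + 1) → ℤ)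
    {p : Fin (d + 1) → ℝ} (hp : p ∈ BZ (d + 1)) :
    kFibΔLim Lc a x' b y' (ofRealVec p) = kFibΔLim Lc a (repZ (Torus.proj Lc x')) b (repZ (Torus.proj Lc y')) (ofRealVec p) := by
  rw [kFibΔLim_apply, kFibLim_eq_cphase_mul_repZ hθ1 hB a b x' y' hp, ← mul_assoc, ← cphase_add_eq_mul, sub_add_sub_cancel, sub_self,
    cphase_zero_left, one_mul]

/-! ## §2 Continuity on the real zone -/

/-- [folklore] Each re-based fibre function restricted to the real zone is continuous there ((I3′): continuity on the closed strip ⊇ the zone). -/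
theorem continuousOn_kFibΔ {κ Cst : ℝ} (hκ : 0 ≤ κ) (hA : StripRegularK d Lc κ Cst) (j : ℕ) (a : Fib d) (x' : Fin (d + 1) → ℤ) (b : Fib d)
    (y' : Fin (d + 1) → ℤ) : ContinuousOn (fun p => kFibΔ Lc (sfStep Lc) (smStep d Lc) j a x' b y' (ofRealVec p)) (BZ (d + 1)) :=
  (hA j x' y' a b).cont.comp continuous_ofRealVec.continuousOn fun _ hp => ofRealVec_mem_Strip hκ hp

/-- [our object] **THE CONVERGENCE IS UNIFORM ON THE REAL ZONE** (under (I2′), `0 ≤ θ < 1`): the tail `c·θ^j/(1 − θ)` is momentum-free. -/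
theorem tendstoUniformlyOn_kFibΔ {c θ : ℝ} (hθ0 : 0 ≤ θ) (hθ1 : θ < 1) (hB : RealRateK d Lc c θ) (a : Fib d) (x' : Fin (d + 1) → ℤ) (b : Fib d)
    (y' : Fin (d + 1) → ℤ) :
    TendstoUniformlyOn (fun j p => kFibΔ Lc (sfStep Lc) (smStep d Lc) j a x' b y' (ofRealVec p))
      (fun p => kFibΔLim Lc a x' b y' (ofRealVec p)) atTop (BZ (d + 1)) := by
  rw [Metric.tendstoUniformlyOn_iff]
  intro ε hε
  have ht : Tendsto (fun j : ℕ => c * θ ^ j / (1 - θ)) atTop (𝓝 (c * 0 / (1 - θ))) :=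
    ((tendsto_pow_atTop_nhds_zero_of_lt_one hθ0 hθ1).const_mul c).div_const _
  rw [mul_zero, zero_div] at ht
  filter_upwards [(tendsto_order.1 ht).2 ε hε] with j hj p hp
  rw [dist_comm, dist_eq_norm]
  exact (norm_kFibΔ_sub_kFibΔLim_le hθ1 hB a x' b y' hp j).trans_lt hj

/-- [our object] **THE RE-BASED LIMIT FIBRE FUNCTION IS CONTINUOUS ON THE REAL ZONE** (under (I2′) ∧ (I3′)): a uniform limit of continuous functions. -/
theorem continuousOn_kFibΔLim {c θ κ Cst : ℝ} (hθ0 : 0 ≤ θ) (hθ1 : θ < 1) (hB : RealRateK d Lc c θ) (hκ : 0 ≤ κ) (hA : StripRegularK d Lc κ Cst)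
    (a : Fib d) (x' : Fin (d + 1) → ℤ) (b : Fib d) (y' : Fin (d + 1) → ℤ) :
    ContinuousOn (fun p => kFibΔLim Lc a x' b y' (ofRealVec p)) (BZ (d + 1)) :=
  (tendstoUniformlyOn_kFibΔ hθ0 hθ1 hB a x' b y').continuousOn
    (Eventually.of_forall fun j => continuousOn_kFibΔ hκ hA j a x' b y').frequently

/-- [our object] … and so is the limit fibre function itself (it differs by the continuous unimodular phase `cphase (quo x′ − quo y′)`). -/
theorem continuousOn_kFibLim {c θ κ Cst : ℝ} (hθ0 : 0 ≤ θ) (hθ1 : θ < 1) (hB : RealRateK d Lc c θ) (hκ : 0 ≤ κ) (hA : StripRegularK d Lc κ Cst)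
    (a : Fib d) (x' : Fin (d + 1) → ℤ) (b : Fib d) (y' : Fin (d + 1) → ℤ) :
    ContinuousOn (fun p => kFibLim Lc a x' b y' (ofRealVec p)) (BZ (d + 1)) := by
  have hph : Continuous fun p : Fin (d + 1) → ℝ => cphase (quo Lc x' - quo Lc y') (ofRealVec p) := by
    unfold cphase ofRealVec; fun_prop
  have heq : ∀ p : Fin (d + 1) → ℝ, kFibLim Lc a x' b y' (ofRealVec p) =
      cphase (quo Lc x' - quo Lc y') (ofRealVec p) * kFibΔLim Lc a x' b y' (ofRealVec p) := by
    intro p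
    rw [kFibΔLim_apply, ← mul_assoc, ← cphase_add_eq_mul, sub_add_sub_cancel, sub_self, cphase_zero_left, one_mul]
  simp_rw [heq]
  exact hph.continuousOn.mul (continuousOn_kFibΔLim hθ0 hθ1 hB hκ hA a x' b y')

/-! ## §3 The perfect one-step resolvent in Bloch form -/

/-- [our object] **THE PERFECT ONE-STEP RESOLVENT IN BLOCH FORM (general `d`, under (I2′) ∧ (I3′))**: for every leg pair `a b` and base points `x′ y′`,
`KPerf Lc (sfStep Lc) (smStep d Lc) 1 x′ y′ a b = [LegOn Lc a x′ ∧ LegOn Lc b y′] · Re latticeKernel (kFibΔLim Lc a (repZ (proj Lc x′)) b (repZ (proj Lc y′))) (quo Lc x′ − quo Lc y′)`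
— the block labels enter ONLY through the Fourier phase `e^{ip·(quo x′ − quo y′)}`, the residues index finitely many bounded continuous multipliers. -/
theorem KPerf_one_eq_bloch_of_shapes {c θ κ Cst : ℝ} (hθ1 : θ < 1) (hB : RealRateK d Lc c θ) (hκ : 0 ≤ κ) (hA : StripRegularK d Lc κ Cst)
    (x' y' : Fin (d + 1) → ℤ) (a b : Fib d) :
    KPerf (d := d) Lc (sfStep Lc) (smStep d Lc) 1 x' y' a b =
      if LegOn Lc a x' ∧ LegOn Lc b y' then
        (latticeKernel (kFibΔLim Lc a (repZ (Torus.proj Lc x')) b (repZ (Torus.proj Lc y'))) (quo Lc x' - quo Lc y')).re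
      else 0 := by
  rw [KPerf_one_eq_fibre_of_shapes hθ1 hB hκ hA x' y' a b,
    latticeKernel_congr (G2 := fun P => cphase (quo Lc x' - quo Lc y') P *
      kFibΔLim Lc a (repZ (Torus.proj Lc x')) b (repZ (Torus.proj Lc y')) P)
      (fun p hp => kFibLim_eq_cphase_mul_repZ hθ1 hB a b x' y' hp) 0, latticeKernel_cphase_mul_zero]

end Generic

/-! ## §4 Dimension four (`d = 3`), every `Lc ≥ 2`: unconditional -/

section Four

variable {Lc : ℕ} [NeZero Lc]

/-- [our object] **CONVERGENCE OF THE RE-BASED FIBRE FUNCTIONS, UNCONDITIONAL** (`d = 3`, `2 ≤ Lc`), every real momentum. -/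
theorem tendsto_kFibΔ_kFibΔLim_holds (hLc : 2 ≤ Lc) (a : Fib 3) (x' : Fin (3 + 1) → ℤ) (b : Fib 3) (y' : Fin (3 + 1) → ℤ)
    {p : Fin (3 + 1) → ℝ} (hp : p ∈ BZ (3 + 1)) :
    Tendsto (fun j => kFibΔ Lc (sfStep Lc) (smStep 3 Lc) j a x' b y' (ofRealVec p)) atTop (𝓝 (kFibΔLim Lc a x' b y' (ofRealVec p))) :=
  tendsto_kFibΔ_kFibΔLim (theta_nonneg_lt_one hLc).2 (realRateK hLc) a x' b y' hp

/-- [our object] **UNIFORM CONVERGENCE ON THE REAL ZONE, UNCONDITIONAL** (`d = 3`, `2 ≤ Lc`). -/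
theorem tendstoUniformlyOn_kFibΔ_holds (hLc : 2 ≤ Lc) (a : Fib 3) (x' : Fin (3 + 1) → ℤ) (b : Fib 3) (y' : Fin (3 + 1) → ℤ) :
    TendstoUniformlyOn (fun j p => kFibΔ Lc (sfStep Lc) (smStep 3 Lc) j a x' b y' (ofRealVec p))
      (fun p => kFibΔLim Lc a x' b y' (ofRealVec p)) atTop (BZ (3 + 1)) :=
  tendstoUniformlyOn_kFibΔ (theta_nonneg_lt_one hLc).1 (theta_nonneg_lt_one hLc).2 (realRateK hLc) a x' b y'

/-- **THE RE-BASED LIMIT FIBRE FUNCTIONS ARE CONTINUOUS ON THE REAL ZONE — UNCONDITIONAL** (`d = 3`, every `Lc ≥ 2`). [our object] -/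
theorem continuousOn_kFibΔLim_holds (hLc : 2 ≤ Lc) (a : Fib 3) (x' : Fin (3 + 1) → ℤ) (b : Fib 3) (y' : Fin (3 + 1) → ℤ) :
    ContinuousOn (fun p => kFibΔLim Lc a x' b y' (ofRealVec p)) (BZ (3 + 1)) := by
  obtain ⟨κ, hκ, Cst, hA⟩ := fibreStrip (Lc := Lc)
  exact continuousOn_kFibΔLim (theta_nonneg_lt_one hLc).1 (theta_nonneg_lt_one hLc).2 (realRateK hLc) hκ.le hA a x' b y'

/-- [our object] … and so are the limit fibre functions `kFibLim` (`d = 3`, `2 ≤ Lc`). -/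
theorem continuousOn_kFibLim_holds (hLc : 2 ≤ Lc) (a : Fib 3) (x' : Fin (3 + 1) → ℤ) (b : Fib 3) (y' : Fin (3 + 1) → ℤ) :
    ContinuousOn (fun p => kFibLim Lc a x' b y' (ofRealVec p)) (BZ (3 + 1)) := by
  obtain ⟨κ, hκ, Cst, hA⟩ := fibreStrip (Lc := Lc)
  exact continuousOn_kFibLim (theta_nonneg_lt_one hLc).1 (theta_nonneg_lt_one hLc).2 (realRateK hLc) hκ.le hA a x' b y'

/-- [our object] **ONE BOUND FOR ALL RE-BASED LIMIT FIBRE FUNCTIONS** (`d = 3`, `2 ≤ Lc`): the (I3′) constant. -/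
theorem exists_norm_kFibΔLim_le (hLc : 2 ≤ Lc) :
    ∃ Cst : ℝ, 0 ≤ Cst ∧ ∀ (a : Fib 3) (x' : Fin (3 + 1) → ℤ) (b : Fib 3) (y' : Fin (3 + 1) → ℤ), ∀ p ∈ BZ (3 + 1),
      ‖kFibΔLim Lc a x' b y' (ofRealVec p)‖ ≤ Cst := by
  obtain ⟨κ, hκ, Cst, hA⟩ := fibreStrip (Lc := Lc)
  exact ⟨Cst, Cst_nonneg hκ.le hA, fun a x' b y' p hp => norm_kFibΔLim_le (theta_nonneg_lt_one hLc).2 (realRateK hLc) hκ.le hA a x' b y' hp⟩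

/-- [our object] **RESIDUE REDUCTION, UNCONDITIONAL** (`d = 3`, `2 ≤ Lc`): `kFibΔLim … a x′ b y′ = kFibΔLim … a (repZ (proj x′)) b (repZ (proj y′))` on the real zone —
at most `(Lc⁴)² × |Fib 3|²` distinct multipliers. -/
theorem kFibΔLim_eq_repZ_holds (hLc : 2 ≤ Lc) (a b : Fib 3) (x' y' : Fin (3 + 1) → ℤ) {p : Fin (3 + 1) → ℝ} (hp : p ∈ BZ (3 + 1)) :
    kFibΔLim Lc a x' b y' (ofRealVec p) = kFibΔLim Lc a (repZ (Torus.proj Lc x')) b (repZ (Torus.proj Lc y')) (ofRealVec p) :=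
  kFibΔLim_eq_repZ (theta_nonneg_lt_one hLc).2 (realRateK hLc) a b x' y' hp

/-- [our object] Block-translation invariance, UNCONDITIONAL (`d = 3`, `2 ≤ Lc`), both base points at once: the SAME coarse shift leaves `kFibΔLim` unchanged. -/
theorem kFibΔLim_add_zsmul_holds (hLc : 2 ≤ Lc) (a b : Fib 3) (x' y' v : Fin (3 + 1) → ℤ) {p : Fin (3 + 1) → ℝ} (hp : p ∈ BZ (3 + 1)) :
    kFibΔLim Lc a (x' + (Lc : ℤ) • v) b (y' + (Lc : ℤ) • v) (ofRealVec p) = kFibΔLim Lc a x' b y' (ofRealVec p) := by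
  rw [kFibΔLim_add_zsmul_left (theta_nonneg_lt_one hLc).2 (realRateK hLc) a b x' _ v hp,
    kFibΔLim_add_zsmul_right (theta_nonneg_lt_one hLc).2 (realRateK hLc) a b x' y' v hp]

/-- **THE PERFECT ONE-STEP RESOLVENT IS A BLOCH KERNEL — UNCONDITIONAL** (`d = 3`, every `Lc ≥ 2`, adopted units): for every leg pair `a b : Fib 3` and base points
`x′ y′ : ℤ⁴`,
`KPerf Lc (sfStep Lc) (smStep 3 Lc) 1 x′ y′ a b = [LegOn Lc a x′ ∧ LegOn Lc b y′] · Re (2π)^{−4} ∫_{[-π,π]⁴} e^{ip·(quo Lc x′ − quo Lc y′)} kFibΔLim Lc a (repZ (proj Lc x′)) b (repZ (proj Lc y′)) (p) dp`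
— the BLOCK LABELS `quo x′, quo y′` enter only through the Fourier phase of their DIFFERENCE; the multiplier is indexed by the two intra-block RESIDUES and the legs
(finitely many), is bounded (`exists_norm_kFibΔLim_le`) and continuous on the zone (`continuousOn_kFibΔLim_holds`), and is the uniform real-zone limit of road P1's
explicit finite fibre functions `kFibΔ … j`.  `KPerf_one_eq_bloch_of_shapes` fed with `FibreRate.realRateK hLc` (I2′) and `FibreStrip.fibreStrip` (I3′). [our object] -/
theorem KPerf_one_eq_bloch (hLc : 2 ≤ Lc) (x' y' : Fin (3 + 1) → ℤ) (a b : Fib 3) :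
    KPerf (d := 3) Lc (sfStep Lc) (smStep 3 Lc) 1 x' y' a b =
      if LegOn Lc a x' ∧ LegOn Lc b y' then
        (latticeKernel (kFibΔLim Lc a (repZ (Torus.proj Lc x')) b (repZ (Torus.proj Lc y'))) (quo Lc x' - quo Lc y')).re
      else 0 := by
  obtain ⟨κ, hκ, Cst, hA⟩ := fibreStrip (Lc := Lc)
  exact KPerf_one_eq_bloch_of_shapes (theta_nonneg_lt_one hLc).2 (realRateK hLc) hκ.le hA x' y' a b

/-- [our object] FIELD–FIELD block in Bloch form (field legs are everywhere on). -/
theorem KPerf_one_inl_inl_bloch (hLc : 2 ≤ Lc) (x' y' : Fin (3 + 1) → ℤ) (κ l : Fin (3 + 1)) :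
    KPerf (d := 3) Lc (sfStep Lc) (smStep 3 Lc) 1 x' y' (Sum.inl κ) (Sum.inl l) =
      (latticeKernel (kFibΔLim Lc (Sum.inl κ) (repZ (Torus.proj Lc x')) (Sum.inl l) (repZ (Torus.proj Lc y'))) (quo Lc x' - quo Lc y')).re := by
  rw [KPerf_one_eq_bloch hLc, if_pos ⟨trivial, trivial⟩]

end Four

end

end Summit.QuantumFields.BalabanUV.Beta.GAN24.PerfectStepBloch
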